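import Mathlib.Algebra.MvPolynomial.Equiv
import Mathlib.Algebra.MvPolynomial.CommRing
import Mathlib.Algebra.Polynomial.Div
import Mathlib.RingTheory.AdjoinRoot
import HarnessLib

/-!
# Degree bookkeeping for Kaltofen's coefficient-growth analysis (tools)

Support file for the proof of Kaltofen's Theorem 7 (`kaltofen1995_thm7`; E. Kaltofen, *Effective
Noether irreducibility forms and applications*, J. Comput. System Sci. 50 (1995) 274–295), more
precisely for the DEGREE half of his §3 "Coefficient Growth Analysis" (Lemma 1, Thms. 1, 2, 4:
`deg_{c's}` of every intermediate quantity of the absolute irreducibility test run on the generic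
polynomial), applied to the objects of `KaltofenTestDefs` in the sibling files
`KaltofenBoundsGeneric*`.

Kaltofen's Lemma 1 (p. 11 of the paper) controls the growth of the degree in the generic
coefficients `c` under reduction modulo the monic `f₀(z) = z^d + Σ c_{i,0} zⁱ`: each division step
costs one degree. We package this as a VALUATION-LIKE quantity that does not grow at all:

* `wdeg P`, for `P ∈ A[σ][z]`: the total degree of `P` read in `A[σ ⊕ {z}]`, i.e. the largest
  `deg_σ(P_j) + j` over the `zʲ`-coefficients `P_j` (the variable `z` has weight `1`). It is
  subadditive, submultiplicative (`wdeg_mul_le`), dominates `deg_σ` of every coefficient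
  (`totalDegree_coeff_le_wdeg`), and — the point — does not increase under `%ₘ f` for a monic `f`
  with `wdeg f ≤ deg_z f` (`wdeg_modByMonic_le`; this is Kaltofen's Lemma 1).
* `rdeg hf a`, for `a ∈ A[σ][z]/(f)` (`AdjoinRoot f`, `f` monic): `wdeg` of the canonical
  representative; again subadditive and submultiplicative (`rdeg_mul_le`).
* `sdeg hf A Q`, for `Q ∈ (A[σ][z]/(f))[Y]`: the least `c` with `rdeg [Y^k]Q ≤ A·k + c` for all
  `k` ("slope-`A` defect"); subadditive, submultiplicative (`sdeg_mul_le`), and multiplication by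
  `Y^s` lowers it by `A·s` (`sdeg_X_pow_mul_le`). This is the shape of the inductive degree bounds
  of Kaltofen's Thms. 1–2 (`deg ā_k ≤ (slope)·k − const`).

Everything here is [folklore]; no cited statements, no named facts.

## References

* E. Kaltofen, J. Comput. System Sci. 50 (1995) 274–295, §3 Lemma 1, Thms. 1, 2. [Kaltofen1995]
-/

noncomputable section

open Polynomial

namespace Literature.RingTheory.MvPolynomial.KaltofenBounds

universe u v

variable {σ : Type u} {A : Type v} [CommRing A]

/-! ### `wdeg`: total degree with the polynomial variable of weight one -/

/-- `wdeg P` = total degree of `P ∈ A[σ][z]` as a polynomial in `σ ⊕ {z}` (the variable `z` of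
weight `1`): the maximum of `deg_σ(P_j) + j` over the nonzero `zʲ`-coefficients. [folklore] -/
def wdeg (P : Polynomial (MvPolynomial σ A)) : ℕ :=
  ((MvPolynomial.optionEquivLeft A σ).symm P).totalDegree

omit [CommRing A] in
/-- `optionEquivLeft` sends `rename some a` to the constant `C a`. [folklore] -/
theorem optionEquivLeft_rename_some [CommRing A] (a : MvPolynomial σ A) :
    MvPolynomial.optionEquivLeft A σ (MvPolynomial.rename some a) = Polynomial.C a := by
  induction a using MvPolynomial.induction_on with
  | C r => rw [MvPolynomial.rename_C, MvPolynomial.optionEquivLeft_C]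
  | add p q hp hq => rw [map_add, map_add, hp, hq, Polynomial.C_add]
  | mul_X p i hp =>
    rw [map_mul, map_mul, hp, MvPolynomial.rename_X, MvPolynomial.optionEquivLeft_X_some,
      Polynomial.C_mul]

/-- The inverse of `optionEquivLeft` on constants. [folklore] -/
theorem optionEquivLeft_symm_C (a : MvPolynomial σ A) :
    (MvPolynomial.optionEquivLeft A σ).symm (Polynomial.C a) = MvPolynomial.rename some a := by
  apply (MvPolynomial.optionEquivLeft A σ).injective
  rw [AlgEquiv.apply_symm_apply, optionEquivLeft_rename_some]

/-- `wdeg 0 = 0`. [folklore] -/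
@[simp] theorem wdeg_zero : wdeg (0 : Polynomial (MvPolynomial σ A)) = 0 := by
  simp [wdeg]

/-- `wdeg 1 = 0`. [folklore] -/
@[simp] theorem wdeg_one : wdeg (1 : Polynomial (MvPolynomial σ A)) = 0 := by
  simp [wdeg]

/-- `wdeg` of an integer constant. [folklore] -/
@[simp] theorem wdeg_intCast (n : ℤ) : wdeg ((n : Polynomial (MvPolynomial σ A))) = 0 := by
  unfold wdeg
  rw [map_intCast, ← map_intCast (MvPolynomial.C : A →+* MvPolynomial (Option σ) A) n]
  exact MvPolynomial.totalDegree_C _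

/-- `wdeg` of a natural-number constant. [folklore] -/
@[simp] theorem wdeg_natCast (n : ℕ) : wdeg ((n : Polynomial (MvPolynomial σ A))) = 0 := by
  have := wdeg_intCast (σ := σ) (A := A) (n : ℤ)
  rwa [Int.cast_natCast] at this

/-- Subadditivity. [folklore] -/
theorem wdeg_add_le (P Q : Polynomial (MvPolynomial σ A)) : wdeg (P + Q) ≤ max (wdeg P) (wdeg Q) := by
  unfold wdeg; rw [map_add]; exact MvPolynomial.totalDegree_add _ _

/-- `wdeg (-P) = wdeg P`. [folklore] -/
@[simp] theorem wdeg_neg (P : Polynomial (MvPolynomial σ A)) : wdeg (-P) = wdeg P := by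
  unfold wdeg; rw [map_neg, MvPolynomial.totalDegree_neg]

/-- Subadditivity for differences. [folklore] -/
theorem wdeg_sub_le (P Q : Polynomial (MvPolynomial σ A)) : wdeg (P - Q) ≤ max (wdeg P) (wdeg Q) := by
  unfold wdeg; rw [map_sub]; exact MvPolynomial.totalDegree_sub _ _

/-- `wdeg` of a finite sum. [folklore] -/
theorem wdeg_sum_le {ι : Type*} (s : Finset ι) (g : ι → Polynomial (MvPolynomial σ A)) :
    wdeg (∑ i ∈ s, g i) ≤ s.sup fun i => wdeg (g i) := by
  unfold wdeg; rw [map_sum]; exact MvPolynomial.totalDegree_finsetSum _ _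

/-- Submultiplicativity. [folklore] -/
theorem wdeg_mul_le (P Q : Polynomial (MvPolynomial σ A)) : wdeg (P * Q) ≤ wdeg P + wdeg Q := by
  unfold wdeg; rw [map_mul]; exact MvPolynomial.totalDegree_mul _ _

/-- Powers. [folklore] -/
theorem wdeg_pow_le (P : Polynomial (MvPolynomial σ A)) (n : ℕ) : wdeg (P ^ n) ≤ n * wdeg P := by
  unfold wdeg; rw [map_pow]; exact MvPolynomial.totalDegree_pow _ _

/-- Finite products. [folklore] -/
theorem wdeg_prod_le {ι : Type*} (s : Finset ι) (g : ι → Polynomial (MvPolynomial σ A)) :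
    wdeg (∏ i ∈ s, g i) ≤ ∑ i ∈ s, wdeg (g i) := by
  unfold wdeg; rw [map_prod]; exact MvPolynomial.totalDegree_finsetProd _ _

/-- Constants: `wdeg (C a) ≤ deg a`. [folklore] -/
theorem wdeg_C_le (a : MvPolynomial σ A) : wdeg (Polynomial.C a) ≤ a.totalDegree := by
  unfold wdeg; rw [optionEquivLeft_symm_C]; exact MvPolynomial.totalDegree_rename_le _ _

/-- The variable: `wdeg z ≤ 1`. [folklore] -/
theorem wdeg_X_le : wdeg (Polynomial.X : Polynomial (MvPolynomial σ A)) ≤ 1 := by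
  unfold wdeg
  rw [MvPolynomial.optionEquivLeft_symm_X]
  refine (MvPolynomial.totalDegree_monomial_le _ _).trans ?_
  simp

/-- `wdeg (zʲ) ≤ j`. [folklore] -/
theorem wdeg_X_pow_le (j : ℕ) : wdeg ((Polynomial.X : Polynomial (MvPolynomial σ A)) ^ j) ≤ j := by
  refine (wdeg_pow_le _ _).trans ?_
  have := wdeg_X_le (σ := σ) (A := A)
  calc j * wdeg (Polynomial.X : Polynomial (MvPolynomial σ A)) ≤ j * 1 := Nat.mul_le_mul_left j this
    _ = j := mul_one j

/-- Monomials: `wdeg (C a zʲ) ≤ deg a + j`. [folklore] -/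
theorem wdeg_C_mul_X_pow_le (a : MvPolynomial σ A) (j : ℕ) :
    wdeg (Polynomial.C a * Polynomial.X ^ j) ≤ a.totalDegree + j :=
  (wdeg_mul_le _ _).trans (add_le_add (wdeg_C_le a) (wdeg_X_pow_le j))

/-- Every coefficient has `deg_σ ≤ wdeg`. [folklore] -/
theorem totalDegree_coeff_le_wdeg (P : Polynomial (MvPolynomial σ A)) (j : ℕ) :
    (P.coeff j).totalDegree ≤ wdeg P := by
  have h := MvPolynomial.totalDegree_coeff_optionEquivLeft_le (R := A) (S₁ := σ)
    ((MvPolynomial.optionEquivLeft A σ).symm P) j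
  rwa [AlgEquiv.apply_symm_apply] at h

/-- The `z`-degree is at most `wdeg`. [folklore] -/
theorem natDegree_le_wdeg (P : Polynomial (MvPolynomial σ A)) : P.natDegree ≤ wdeg P := by
  have h := MvPolynomial.natDegree_optionEquivLeft (R := A) (σ := σ)
    ((MvPolynomial.optionEquivLeft A σ).symm P)
  rw [AlgEquiv.apply_symm_apply] at h
  rw [h]
  exact MvPolynomial.degreeOf_le_totalDegree _ _

/-- A nonzero coefficient satisfies `deg_σ(P_j) + j ≤ wdeg P`. [folklore] -/
theorem totalDegree_coeff_add_le_wdeg (P : Polynomial (MvPolynomial σ A)) (j : ℕ) (hj : P.coeff j ≠ 0) :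
    (P.coeff j).totalDegree + j ≤ wdeg P := by
  have hjw : j ≤ wdeg P := (Polynomial.le_natDegree_of_ne_zero hj).trans (natDegree_le_wdeg P)
  have h := MvPolynomial.totalDegree_coeff_optionEquivLeft_add_le (R := A) (S₁ := σ)
    ((MvPolynomial.optionEquivLeft A σ).symm P) j hjw
  rwa [AlgEquiv.apply_symm_apply] at h

/-- **Kaltofen's Lemma 1, valuation form.** Reduction modulo a monic `f` with `wdeg f ≤ deg_z f`
(e.g. `f₀ = z^d + Σ c_{i,0} zⁱ`) does not increase `wdeg`. [cite: Kaltofen1995, §3 Lemma 1] -/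
theorem wdeg_modByMonic_le {f : Polynomial (MvPolynomial σ A)} (hf : f.Monic) (hfw : wdeg f ≤ f.natDegree)
    (P : Polynomial (MvPolynomial σ A)) : wdeg (P %ₘ f) ≤ wdeg P := by
  rcases subsingleton_or_nontrivial (MvPolynomial σ A) with hA | hA
  · rw [Subsingleton.elim (P %ₘ f) P]
  induction hn : P.natDegree using Nat.strong_induction_on generalizing P with
  | _ n ih =>
    by_cases hlt : P.degree < f.degree
    · rw [(Polynomial.modByMonic_eq_self_iff hf).2 hlt]
    by_cases hP0 : P = 0
    · rw [hP0, Polynomial.zero_modByMonic]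
    have hle : f.degree ≤ P.degree := not_lt.1 hlt
    set P' := P - f * (Polynomial.C P.leadingCoeff * Polynomial.X ^ (P.natDegree - f.natDegree)) with hP'
    have hdeg : P'.degree < P.degree := Polynomial.div_wf_lemma ⟨hle, hP0⟩ hf
    have hmod : P %ₘ f = P' %ₘ f :=
      Polynomial.modByMonic_eq_of_dvd_sub hf (by rw [hP', sub_sub_cancel]; exact dvd_mul_right _ _)
    have hnat : f.natDegree ≤ P.natDegree := Polynomial.natDegree_le_natDegree hle
    -- `wdeg P' ≤ wdeg P`
    have hwP' : wdeg P' ≤ wdeg P := by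
      rw [hP']
      refine (wdeg_sub_le _ _).trans (max_le le_rfl ?_)
      refine (wdeg_mul_le _ _).trans ?_
      have hlc : P.leadingCoeff.totalDegree + P.natDegree ≤ wdeg P :=
        totalDegree_coeff_add_le_wdeg P P.natDegree (Polynomial.leadingCoeff_ne_zero.2 hP0)
      have h2 := wdeg_C_mul_X_pow_le (P.leadingCoeff) (P.natDegree - f.natDegree)
      omega
    rw [hmod]
    by_cases hP'0 : P' = 0
    · rw [hP'0, Polynomial.zero_modByMonic, wdeg_zero]; exact Nat.zero_le _
    have hlt' : P'.natDegree < n := by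
      rw [← hn]; exact Polynomial.natDegree_lt_natDegree hP'0 hdeg
    exact (ih _ hlt' P' rfl).trans hwP'

/-! ### `rdeg`: the same on `A[σ][z]/(f)` through canonical representatives -/

section RDeg

variable {f : Polynomial (MvPolynomial σ A)}

/-- `rdeg hf a` = `wdeg` of the canonical representative (of `z`-degree `< deg f`) of
`a ∈ A[σ][z]/(f)`, `f` monic. [folklore] -/
def rdeg (hf : f.Monic) (a : AdjoinRoot f) : ℕ := wdeg (AdjoinRoot.modByMonicHom hf a)

variable (hf : f.Monic)

/-- `rdeg 0 = 0`. [folklore] -/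
@[simp] theorem rdeg_zero : rdeg hf 0 = 0 := by simp [rdeg]

/-- `rdeg (mk P) ≤ wdeg P` (Kaltofen's Lemma 1). [cite: Kaltofen1995, §3 Lemma 1] -/
theorem rdeg_mk_le (hfw : wdeg f ≤ f.natDegree) (P : Polynomial (MvPolynomial σ A)) :
    rdeg hf (AdjoinRoot.mk f P) ≤ wdeg P := by
  unfold rdeg; rw [AdjoinRoot.modByMonicHom_mk]; exact wdeg_modByMonic_le hf hfw P

/-- Subadditivity. [folklore] -/
theorem rdeg_add_le (a b : AdjoinRoot f) : rdeg hf (a + b) ≤ max (rdeg hf a) (rdeg hf b) := by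
  unfold rdeg; rw [map_add]; exact wdeg_add_le _ _

/-- `rdeg (-a) = rdeg a`. [folklore] -/
@[simp] theorem rdeg_neg (a : AdjoinRoot f) : rdeg hf (-a) = rdeg hf a := by
  unfold rdeg; rw [map_neg, wdeg_neg]

/-- Subadditivity for differences. [folklore] -/
theorem rdeg_sub_le (a b : AdjoinRoot f) : rdeg hf (a - b) ≤ max (rdeg hf a) (rdeg hf b) := by
  unfold rdeg; rw [map_sub]; exact wdeg_sub_le _ _

/-- `rdeg` of a finite sum. [folklore] -/
theorem rdeg_sum_le {ι : Type*} (s : Finset ι) (g : ι → AdjoinRoot f) :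
    rdeg hf (∑ i ∈ s, g i) ≤ s.sup fun i => rdeg hf (g i) := by
  unfold rdeg; rw [map_sum]; exact wdeg_sum_le _ _

/-- Submultiplicativity (reduce the product of the representatives). [cite: Kaltofen1995, §3 Lemma 1] -/
theorem rdeg_mul_le (hfw : wdeg f ≤ f.natDegree) (a b : AdjoinRoot f) :
    rdeg hf (a * b) ≤ rdeg hf a + rdeg hf b := by
  have ha := AdjoinRoot.mk_leftInverse hf a
  have hb := AdjoinRoot.mk_leftInverse hf b
  conv_lhs => rw [← ha, ← hb, ← map_mul]
  exact (rdeg_mk_le hf hfw _).trans (wdeg_mul_le _ _)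

/-- `rdeg 1 = 0`. [folklore] -/
theorem rdeg_one (hfw : wdeg f ≤ f.natDegree) : rdeg hf 1 = 0 := by
  have h := rdeg_mk_le hf hfw 1
  rw [map_one, wdeg_one] at h
  exact Nat.le_zero.1 h

/-- Powers. [folklore] -/
theorem rdeg_pow_le (hfw : wdeg f ≤ f.natDegree) (a : AdjoinRoot f) (n : ℕ) :
    rdeg hf (a ^ n) ≤ n * rdeg hf a := by
  induction n with
  | zero => rw [pow_zero, rdeg_one hf hfw, zero_mul]
  | succ n ih =>
    rw [pow_succ, Nat.succ_mul]
    exact (rdeg_mul_le hf hfw _ _).trans (add_le_add ih le_rfl)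

/-- Finite products. [folklore] -/
theorem rdeg_prod_le (hfw : wdeg f ≤ f.natDegree) {ι : Type*} (s : Finset ι) (g : ι → AdjoinRoot f) :
    rdeg hf (∏ i ∈ s, g i) ≤ ∑ i ∈ s, rdeg hf (g i) := by
  classical
  induction s using Finset.induction_on with
  | empty => rw [Finset.prod_empty, Finset.sum_empty, rdeg_one hf hfw]
  | insert i s hi ih =>
    rw [Finset.prod_insert hi, Finset.sum_insert hi]
    exact (rdeg_mul_le hf hfw _ _).trans (add_le_add le_rfl ih)

/-- Scalars: `rdeg (of a) ≤ deg a`. [folklore] -/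
theorem rdeg_of_le (hfw : wdeg f ≤ f.natDegree) (a : MvPolynomial σ A) :
    rdeg hf (AdjoinRoot.of f a) ≤ a.totalDegree := by
  rw [← AdjoinRoot.mk_C]
  exact (rdeg_mk_le hf hfw _).trans (wdeg_C_le a)

/-- Scalars through `algebraMap`. [folklore] -/
theorem rdeg_algebraMap_le (hfw : wdeg f ≤ f.natDegree) (a : MvPolynomial σ A) :
    rdeg hf (algebraMap (MvPolynomial σ A) (AdjoinRoot f) a) ≤ a.totalDegree := by
  rw [AdjoinRoot.algebraMap_eq]; exact rdeg_of_le hf hfw a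

/-- The root: `rdeg z̄ ≤ 1`. [folklore] -/
theorem rdeg_root_le (hfw : wdeg f ≤ f.natDegree) : rdeg hf (AdjoinRoot.root f) ≤ 1 := by
  rw [← AdjoinRoot.mk_X]
  exact (rdeg_mk_le hf hfw _).trans wdeg_X_le

/-- Powers of the root: `rdeg z̄ʲ ≤ j`. [folklore] -/
theorem rdeg_root_pow_le (hfw : wdeg f ≤ f.natDegree) (j : ℕ) : rdeg hf (AdjoinRoot.root f ^ j) ≤ j := by
  refine (rdeg_pow_le hf hfw _ j).trans ?_
  calc j * rdeg hf (AdjoinRoot.root f) ≤ j * 1 := Nat.mul_le_mul_left j (rdeg_root_le hf hfw)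
    _ = j := mul_one j

/-- Integer constants have `rdeg 0`. [folklore] -/
theorem rdeg_intCast (hfw : wdeg f ≤ f.natDegree) (n : ℤ) : rdeg hf (n : AdjoinRoot f) = 0 := by
  have h := rdeg_mk_le hf hfw (n : Polynomial (MvPolynomial σ A))
  rw [map_intCast, wdeg_intCast] at h
  exact Nat.le_zero.1 h

/-- Natural-number constants have `rdeg 0`. [folklore] -/
theorem rdeg_natCast (hfw : wdeg f ≤ f.natDegree) (n : ℕ) : rdeg hf (n : AdjoinRoot f) = 0 := by
  have := rdeg_intCast hf hfw (n : ℤ)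
  rwa [Int.cast_natCast] at this

/-- The coefficients of the canonical representative have `deg_σ ≤ rdeg`. [folklore] -/
theorem totalDegree_coeff_modByMonicHom_le (a : AdjoinRoot f) (j : ℕ) :
    ((AdjoinRoot.modByMonicHom hf a).coeff j).totalDegree ≤ rdeg hf a :=
  totalDegree_coeff_le_wdeg _ _

end RDeg

/-! ### `sdeg`: slope-`A` defect of a polynomial over `A[σ][z]/(f)` -/

section SDeg

variable {f : Polynomial (MvPolynomial σ A)}

/-- `sdeg hf A Q` = the least `c` with `rdeg [Y^k]Q ≤ A·k + c` for every `k`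
(`max_k (rdeg [Y^k]Q ∸ A·k)`). [folklore] -/
def sdeg (hf : f.Monic) (A : ℕ) (Q : Polynomial (AdjoinRoot f)) : ℕ :=
  Q.support.sup fun k => rdeg hf (Q.coeff k) - A * k

variable (hf : f.Monic) (A : ℕ)

/-- The defining property of `sdeg`, as an equivalence. [folklore] -/
theorem sdeg_le_iff {Q : Polynomial (AdjoinRoot f)} {c : ℕ} :
    sdeg hf A Q ≤ c ↔ ∀ k, rdeg hf (Q.coeff k) ≤ A * k + c := by
  unfold sdeg
  rw [Finset.sup_le_iff]
  constructor
  · intro h k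
    by_cases hk : k ∈ Q.support
    · have := h k hk
      omega
    · rw [Polynomial.notMem_support_iff.1 hk, rdeg_zero]; exact Nat.zero_le _
  · intro h k _
    have := h k
    omega

/-- Each coefficient is controlled by `sdeg`. [folklore] -/
theorem rdeg_coeff_le_sdeg (Q : Polynomial (AdjoinRoot f)) (k : ℕ) :
    rdeg hf (Q.coeff k) ≤ A * k + sdeg hf A Q :=
  (sdeg_le_iff hf A).1 le_rfl k

/-- `sdeg 0 = 0`. [folklore] -/
@[simp] theorem sdeg_zero : sdeg hf A (0 : Polynomial (AdjoinRoot f)) = 0 := by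
  simp [sdeg]

/-- Subadditivity. [folklore] -/
theorem sdeg_add_le (Q Q' : Polynomial (AdjoinRoot f)) :
    sdeg hf A (Q + Q') ≤ max (sdeg hf A Q) (sdeg hf A Q') := by
  rw [sdeg_le_iff]
  intro k
  rw [Polynomial.coeff_add]
  refine (rdeg_add_le hf _ _).trans (max_le ?_ ?_)
  · exact (rdeg_coeff_le_sdeg hf A Q k).trans (by omega)
  · exact (rdeg_coeff_le_sdeg hf A Q' k).trans (by omega)

/-- `sdeg (-Q) = sdeg Q`. [folklore] -/
@[simp] theorem sdeg_neg (Q : Polynomial (AdjoinRoot f)) : sdeg hf A (-Q) = sdeg hf A Q := by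
  unfold sdeg
  rw [Polynomial.support_neg]
  refine Finset.sup_congr rfl fun k _ => ?_
  rw [Polynomial.coeff_neg, rdeg_neg]

/-- Subadditivity for differences. [folklore] -/
theorem sdeg_sub_le (Q Q' : Polynomial (AdjoinRoot f)) :
    sdeg hf A (Q - Q') ≤ max (sdeg hf A Q) (sdeg hf A Q') := by
  rw [sub_eq_add_neg]
  refine (sdeg_add_le hf A _ _).trans ?_
  rw [sdeg_neg]

/-- `sdeg` of a finite sum. [folklore] -/
theorem sdeg_sum_le {ι : Type*} (s : Finset ι) (g : ι → Polynomial (AdjoinRoot f)) :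
    sdeg hf A (∑ i ∈ s, g i) ≤ s.sup fun i => sdeg hf A (g i) := by
  classical
  induction s using Finset.induction_on with
  | empty => rw [Finset.sum_empty, sdeg_zero]; exact Nat.zero_le _
  | insert i s hi ih =>
    rw [Finset.sum_insert hi, Finset.sup_insert]
    exact (sdeg_add_le hf A _ _).trans (max_le_max le_rfl ih)

/-- Constants: `sdeg (C a) ≤ rdeg a`. [folklore] -/
theorem sdeg_C_le (a : AdjoinRoot f) : sdeg hf A (Polynomial.C a) ≤ rdeg hf a := by
  rw [sdeg_le_iff]
  intro k
  rw [Polynomial.coeff_C]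
  split_ifs
  · omega
  · rw [rdeg_zero]; exact Nat.zero_le _

/-- Submultiplicativity of the slope defect. [folklore] -/
theorem sdeg_mul_le (hfw : wdeg f ≤ f.natDegree) (Q Q' : Polynomial (AdjoinRoot f)) :
    sdeg hf A (Q * Q') ≤ sdeg hf A Q + sdeg hf A Q' := by
  rw [sdeg_le_iff]
  intro k
  rw [Polynomial.coeff_mul]
  refine (rdeg_sum_le hf _ _).trans (Finset.sup_le fun x hx => ?_)
  rw [Finset.mem_antidiagonal] at hx
  refine (rdeg_mul_le hf hfw _ _).trans ?_
  have h1 := rdeg_coeff_le_sdeg hf A Q x.1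
  have h2 := rdeg_coeff_le_sdeg hf A Q' x.2
  have : A * x.1 + A * x.2 = A * k := by rw [← mul_add, hx]
  omega

/-- `sdeg 1 = 0`. [folklore] -/
theorem sdeg_one (hfw : wdeg f ≤ f.natDegree) : sdeg hf A (1 : Polynomial (AdjoinRoot f)) = 0 := by
  have h := sdeg_C_le hf A (1 : AdjoinRoot f)
  rw [Polynomial.C_1, rdeg_one hf hfw] at h
  exact Nat.le_zero.1 h

/-- Powers. [folklore] -/
theorem sdeg_pow_le (hfw : wdeg f ≤ f.natDegree) (Q : Polynomial (AdjoinRoot f)) (n : ℕ) :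
    sdeg hf A (Q ^ n) ≤ n * sdeg hf A Q := by
  induction n with
  | zero => rw [pow_zero, sdeg_one hf A hfw, zero_mul]
  | succ n ih =>
    rw [pow_succ, Nat.succ_mul]
    exact (sdeg_mul_le hf A hfw _ _).trans (add_le_add ih le_rfl)

/-- Finite products. [folklore] -/
theorem sdeg_prod_le (hfw : wdeg f ≤ f.natDegree) {ι : Type*} (s : Finset ι)
    (g : ι → Polynomial (AdjoinRoot f)) :
    sdeg hf A (∏ i ∈ s, g i) ≤ ∑ i ∈ s, sdeg hf A (g i) := by
  classical
  induction s using Finset.induction_on with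
  | empty => rw [Finset.prod_empty, Finset.sum_empty, sdeg_one hf A hfw]
  | insert i s hi ih =>
    rw [Finset.prod_insert hi, Finset.sum_insert hi]
    exact (sdeg_mul_le hf A hfw _ _).trans (add_le_add le_rfl ih)

/-- Multiplication by `Y^s` lowers the defect by `A·s`. [folklore] -/
theorem sdeg_X_pow_mul_le (s : ℕ) (Q : Polynomial (AdjoinRoot f)) :
    sdeg hf A (Polynomial.X ^ s * Q) ≤ sdeg hf A Q - A * s := by
  rw [sdeg_le_iff]
  intro k
  rw [Polynomial.coeff_X_pow_mul']
  split_ifs with hsk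
  · have h := rdeg_coeff_le_sdeg hf A Q (k - s)
    have hk : A * (k - s) + A * s = A * k := by rw [← mul_add, Nat.sub_add_cancel hsk]
    omega
  · rw [rdeg_zero]; exact Nat.zero_le _

/-- Multiplication by `Y` lowers the defect by `A`. [folklore] -/
theorem sdeg_X_mul_le (Q : Polynomial (AdjoinRoot f)) :
    sdeg hf A (Polynomial.X * Q) ≤ sdeg hf A Q - A := by
  simpa using sdeg_X_pow_mul_le hf A 1 Q

/-- `sdeg (C a * Q) ≤ rdeg a + sdeg Q`. [folklore] -/
theorem sdeg_C_mul_le (hfw : wdeg f ≤ f.natDegree) (a : AdjoinRoot f) (Q : Polynomial (AdjoinRoot f)) :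
    sdeg hf A (Polynomial.C a * Q) ≤ rdeg hf a + sdeg hf A Q :=
  (sdeg_mul_le hf A hfw _ _).trans (add_le_add (sdeg_C_le hf A a) le_rfl)

/-- Monotonicity in the slope: a larger slope gives a smaller defect. [folklore] -/
theorem sdeg_anti {A A' : ℕ} (h : A ≤ A') (Q : Polynomial (AdjoinRoot f)) : sdeg hf A' Q ≤ sdeg hf A Q := by
  rw [sdeg_le_iff]
  intro k
  have := rdeg_coeff_le_sdeg hf A Q k
  have hk : A * k ≤ A' * k := Nat.mul_le_mul_right k h
  omega

end SDeg

end Literature.RingTheory.MvPolynomial.KaltofenBounds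

end
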